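import Summits.Ventures.HSemireg.Mod4SignLaw

/-!
# Venture HSemireg — (S3)'s positivity input (H1): sign bookkeeping and the SIGNED MOD-4 parity law (second proof route, part 2)

HONEST FRAMING. Part of the Lean index of the computation cell `pub-hsemireg` (TRACK «S4-PUSH» (ii), seat s4-prove-3,
SECOND proof route; work log `s4push/prove-3/ATTEMPT-1.md`).  ORDERED-FIELD ARITHMETIC on top of the exterior-algebra identity
of part 1 (`Mod4SignLaw.lean`: `b(λ)ⁿ = (n!·∏λ_a)·vol`) ONLY: no abelian variety, no sheaf, no Ext group, no semiregularity map, no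
HRR is constructed or proved here; the geometric inputs of th-7's parity law (theory/FORMULA-N-th7.md §D: the value of `(v,v)_χ`,
HRR for a free translation group (H2), the Lemma profile `χ^G = P_n(-1) = -2` at even `n`) enter as VISIBLE HYPOTHESES of the
final theorems, by value.  Nothing here says that HC, HC_CM or HC_AV holds; nothing here is a new case of anything; no Literature
fact is declared or used.

CONTENT (all PROVED, 0 sorry; namespace `Summit.Ventures.HSemireg.Mod4Sign`):
* §4a `topCoeff λ := n!·∏_a λ_a`, `diagForm_pow_eq_topCoeff_smul` / `linearForm_diagForm_pow_eq` — the link to part 1: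
  `deg(b(λ)ⁿ) = topCoeff λ · deg(vol)` for every linear functional `deg` (on paper `deg = ∫_X`, `deg(vol) > 0`).
* §4b `vol_ne_zero_of_linearIndependent` — FRAME-FREE non-vanishing: over a field, for ANY vector space `M` and any
  LINEARLY INDEPENDENT frame `(dx_a, dy_a)_{a<n}` (on paper: a real basis of `H¹(X,ℝ)` adapted to `b`), `vol ≠ 0`
  (transport to part 1's coordinate model along a linear map built with `Basis.span`/`LinearMap.exists_extend` and
  `ExteriorAlgebra.map`); `diagForm_pow_eq_zero_iff_of_linearIndependent`: `b(λ)ⁿ = 0 ⟺ some λ_a = 0`.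
* §4c over a linearly ordered field: `negCount λ = ind(b) := #{a : λ_a < 0}`;
  `topCoeff_pos_iff_even_negCount` / `topCoeff_neg_iff_odd_negCount` — for non-degenerate `b` (all `λ_a ≠ 0`)
  **`n!·∏λ_a > 0 ⟺ ind(b)` even**; `topCoeff_pos_of_pos` (positive definite `b`: (H1) for every structure of record, `b ∝ Θ`),
  `topCoeff_pos_of_neg_of_even` (`-Θ` at even `n`); `linearForm_pow_pos_iff_even_negCount` — with `deg(vol) > 0`:
  **`deg(bⁿ) > 0 ⟺ ind(b)` even** — this is (H1) «∫_X bⁿ > 0» in its exact scope; `linearForm_pow_pos_of_pos` /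
  `linearForm_pow_pos_of_neg_of_even` — (H1) LITERALLY for `b` resp. `-b` (even `n`) a polarisation (binder = positivity of `H_b` in
  the frame + `deg(vol) > 0`, conclusion = the degree inequality); and the COUNTER-MODEL to an unconditional (H1):
  `example : topCoeff ![1, 1, 1, -1] = -24` (on paper `X = E⁴`, `b = e₁+e₂+e₃-e₄`, `K = ℚ(i)`, `B = i·b`: a signature-(4,4)
  secant frame in the sense of th-7 Def. A.2 (ii) with `∫_X b⁴ = -24 < 0`; see part 1's docstring (ii)).
* §5 `chiSelfEven m d w I := 2·w·(-4d)^m·I/(2m)!` = th-7 §D's value of `(v,v)_χ` at `n = 2m` BY VALUE (`w = |x|²|c|²`,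
  `I = ∫_X bⁿ`); three `example`s REPLAY th-7's checker numbers `(κ,κ)_χ = -6, 48, -384` (n = 2, 4, 6; κ = α + β′, d = 2:
  `w = 3/8`, `I = n!`) exactly; `chiSelfEven_neg_iff`: `(v,v)_χ < 0 ⟺ (-1)^m·I < 0` (`d, w > 0`); **`signed_parity_law`**: if
  `(v,v)_χ = g·(-2)` with `g = |G| > 0` (HRR for the free translation group + the Lemma profile, hypotheses by value) then
  `I > 0 ⇒ m` odd and `I < 0 ⇒ m` even; **`signed_parity_law_index`**: with `I = topCoeff λ · V`, `V = ∫vol > 0`, `b`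
  non-degenerate: **`m + ind(b)` is ODD**.  READING: `ind(b) = 0` (th-7's (H1)): Lemma-profile `G`-objects only at `n ≡ 2 (mod 4)`
  among even `n` = STRUCTURE (S3) «only for n ≢ 0 (mod 4)»; `ind(b)` odd: only at `n ≡ 0 (mod 4)` — the law's residue class
  DEPENDS on the index of `b`, so (S3)'s honest binder is «`ind(b)` even» (`four_dvd_two_mul_iff`: `4 ∣ 2m ⟺ m` even).
* §5c `no_G_semiregular_secant_n4` — the `n = 4` clause of (S3) with (H1) `I > 0`, (H2) «`(v,v)_χ = |G|·χ^G`» and (H3)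
  «`e₀^G ≤ 2`, `e₁^G ≥ 8`» (Serre `e₃ = e₁, e₄ = e₀`, pinch `e₂^G = 12`) ALL as visible binders: `χ^G = 2e₀ - 2e₁ + 12 ≤ 0`
  (`pinch_n4_euler_nonpos`) contradicts `(v,v)_χ > 0` — ref-4's precision «the n = 4 clause carries (H3)» kept literally.
* (§5b `lemmaProfile_euler` — the «`χ^G = -2`» input from the TREE's `FormulaN.transversePairRank` — lives in part 3,
  `Mod4SignLawPairing.lean`, next to the pairing step.)

BINDER ↔ PAPER-INPUT TABLE (for the referee's one-to-one diff; nothing below is derived in Lean): `lam : Fin n → K` with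
`negCount lam` ↔ the diagonal frame of `H_b` and its index (Sylvester; existence of the frame = spectral theorem / Gram–Schmidt);
`deg`, `hvol : 0 < deg vol` / `hV : 0 < V` ↔ `∫_X` and the complex orientation; `hd : 0 < d` ↔ `K = ℚ(√-d)` imaginary quadratic;
`hw : 0 < w` ↔ `w = |x|²|c|² > 0`, i.e. the secant vector `v = xℓ + x̄ℓ̄` is NON-ZERO (`x·c ≠ 0`) — NOT a fourth named
hypothesis next to (H1)–(H3) (s4-ref P-1, VERDICT-PROVE-S3-LEAN-2026-08-23); `hHRR : chiSelfEven … = g * χ` with `hg : 0 < g` ↔ HRR on `X/G`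
for `G ⊂` translations acting freely, `χ(F,F) = (v,v)_χ` (Mukai/HRR, td = 1) and th-7 §D's evaluation of `(v,v)_χ` (part 3 derives
the exterior-algebra part of that evaluation); the value `χ = -2` ↔ the Lemma profile `e_k^G = r_k(n)` at even `n` (part 3 §7 computes
`Σ(-1)^k r_k(n) = -2` from the tree's `r_k`); `h0 : e₀ ≤ 2`, `h1 : 8 ≤ e₁` ↔ (H3); Serre symmetry `e₃ = e₁, e₄ = e₀` and the pinch
`e₂^G = 12` ↔ th-7 §C.2 (written into the expression `e₀ - e₁ + 12 - e₁ + e₀`).  WORDING FOR THE RECORD: «(S3)'s arithmetic /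
exterior-algebra core is kernel-checked; the geometric inputs (HRR, (H2), the Lemma profile, the dictionary b ↔ H_b ↔ frame, ∫) are on
paper» — NOT «(S3) is a Lean theorem».

All statements and proofs: s4-prove-3 (2026-08-23).
-/

open Module

namespace Summit.Ventures.HSemireg.Mod4Sign

/-! ### §4a The top coefficient and the link to part 1 -/

section TopCoeff

variable {K : Type*} [CommRing K] {n : ℕ}

/-- the TOP COEFFICIENT `n! · ∏_a λ_a` of `b(λ)ⁿ` with respect to `vol` (on paper: `∫_X bⁿ / ∫_X vol`). -/
def topCoeff (lam : Fin n → K) : K := (n.factorial : K) * ∏ a, lam a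

/-- part 1's sign law in `topCoeff` form: `b(λ)ⁿ = topCoeff λ · vol`. -/
theorem diagForm_pow_eq_topCoeff_smul {M : Type*} [AddCommGroup M] [Module K M] (e f : Fin n → M)
    (lam : Fin n → K) : diagForm K e f lam ^ n = topCoeff lam • vol K e f :=
  diagForm_pow K e f lam

/-- through any functional `deg` («∫_X» on paper): `deg(b(λ)ⁿ) = topCoeff λ · deg(vol)`. -/
theorem linearForm_diagForm_pow_eq {M : Type*} [AddCommGroup M] [Module K M]
    (deg : ExteriorAlgebra K M →ₗ[K] K) (e f : Fin n → M) (lam : Fin n → K) :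
    deg (diagForm K e f lam ^ n) = topCoeff lam * deg (vol K e f) := by
  rw [diagForm_pow_eq_topCoeff_smul, map_smul, smul_eq_mul]

end TopCoeff

/-! ### §4b Frame-free non-vanishing: ANY linearly independent frame in ANY vector space -/

section FrameFree

variable (K : Type*) [Field K] {M N : Type*} [AddCommGroup M] [Module K M] [AddCommGroup N] [Module K N] {n : ℕ}

/-- functoriality of the volume monomial under a linear map `φ` (`Λφ` is an algebra map with `Λφ(ι m) = ι(φ m)`). -/
theorem map_vol (φ : M →ₗ[K] N) (e f : Fin n → M) :
    ExteriorAlgebra.map φ (vol K e f) = vol K (fun a => φ (e a)) (fun a => φ (f a)) := by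
  have hFG : (⇑(ExteriorAlgebra.map φ) ∘ fun a => omega K (e a) (f a)) =
      fun a => omega K (φ (e a)) (φ (f a)) := by
    funext a
    simp [omega, ExteriorAlgebra.map_apply_ι]
  rw [vol, vol, map_list_prod, List.map_ofFn, hFG]

open Summit.Ventures.HSemireg.Wedge in
/-- NON-VANISHING, FRAME-FREE: over a field, for ANY `K`-vector space `M` and any LINEARLY INDEPENDENT frame
`dx_0, dy_0, …, dx_{n-1}, dy_{n-1}` (on paper: a real basis of `H¹(X,ℝ)` adapted to `b`), `vol = ∏_a dx_a ∧ dy_a ≠ 0`.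
Proof: transport to the wedge coordinate model on `Fin (n+n)` (part 1, `vol_ne_zero`) along a linear map `φ` with
`φ(dx_a) = e_{castAdd a}`, `φ(dy_a) = e_{natAdd a}` (exists: extend from the span of the frame). -/
theorem vol_ne_zero_of_linearIndependent (e f : Fin n → M) (h : LinearIndependent K (Sum.elim e f)) :
    vol K e f ≠ 0 := by
  classical
  -- the target frame in the coordinate model
  let I := Fin (n + n)
  let g : Fin n ⊕ Fin n → (I → K) := Sum.elim (fun a => b K I (Fin.castAdd n a)) (fun a => b K I (Fin.natAdd n a))
  -- a linear map φ with φ ∘ (Sum.elim e f) = g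
  let Bs := Module.Basis.span h
  obtain ⟨φ, hφ⟩ := LinearMap.exists_extend (Bs.constr K g)
  have hφv : ∀ i, φ (Sum.elim e f i) = g i := by
    intro i
    have h1 : (Sum.elim e f i) = (Submodule.span K (Set.range (Sum.elim e f))).subtype (Bs i) := by
      rw [Submodule.coe_subtype, Module.Basis.span_apply]
    rw [h1, ← LinearMap.comp_apply, hφ, Module.Basis.constr_basis]
  have hinj : Function.Injective (Sum.elim (Fin.castAdd n : Fin n → I) (Fin.natAdd n)) := by
    have : Sum.elim (Fin.castAdd n : Fin n → I) (Fin.natAdd n) = ⇑finSumFinEquiv := by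
      funext x; cases x <;> simp [finSumFinEquiv_apply_left, finSumFinEquiv_apply_right]
    rw [this]; exact finSumFinEquiv.injective
  intro h0
  have := congrArg (ExteriorAlgebra.map φ) h0
  rw [map_vol, map_zero] at this
  have he : (fun a => φ (e a)) = fun a => b K I (Fin.castAdd n a) := funext fun a => hφv (Sum.inl a)
  have hf : (fun a => φ (f a)) = fun a => b K I (Fin.natAdd n a) := funext fun a => hφv (Sum.inr a)
  rw [he, hf] at this
  exact vol_ne_zero K n _ _ hinj this

/-- hence, frame-free: for a linearly independent frame, `b(λ)ⁿ = 0 ⟺ some λ_a = 0` (non-degenerate `b` ⟺ `bⁿ ≠ 0`). -/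
theorem diagForm_pow_eq_zero_iff_of_linearIndependent [CharZero K] (e f : Fin n → M)
    (h : LinearIndependent K (Sum.elim e f)) (lam : Fin n → K) :
    diagForm K e f lam ^ n = 0 ↔ ∃ a, lam a = 0 := by
  rw [diagForm_pow, smul_eq_zero, mul_eq_zero, Finset.prod_eq_zero_iff]
  constructor
  · rintro ((h0 | ⟨a, -, ha⟩) | h0)
    · exact absurd h0 (Nat.cast_ne_zero.mpr (Nat.factorial_ne_zero n))
    · exact ⟨a, ha⟩
    · exact absurd h0 (vol_ne_zero_of_linearIndependent K e f h)
  · rintro ⟨a, ha⟩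
    exact Or.inl (Or.inr ⟨a, Finset.mem_univ a, ha⟩)

end FrameFree

/-! ### §4c Sign bookkeeping over an ordered field: `sign(n!·∏λ_a) = (-1)^{ind(b)}` -/

section Sign

variable {K : Type*} [Field K] [LinearOrder K] [IsStrictOrderedRing K] {n : ℕ}

/-- the INDEX `ind(b)` of the diagonal form `b(λ)`: the number of negative entries `λ_a < 0`. -/
def negCount (lam : Fin n → K) : ℕ := (Finset.univ.filter fun a => lam a < 0).card

/-- a positive definite `b` (all `λ_a > 0`, i.e. `b` a Kähler / polarisation class) has `n!·∏λ_a > 0`: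
(H1) for every structure of record. -/
theorem topCoeff_pos_of_pos {lam : Fin n → K} (h : ∀ a, 0 < lam a) : 0 < topCoeff lam :=
  mul_pos (by positivity) (Finset.prod_pos fun a _ => h a)

/-- the sign of a product of non-zero entries is `(-1)^{#negative entries}`. -/
theorem neg_one_pow_negCount_mul_prod_pos {lam : Fin n → K} (h : ∀ a, lam a ≠ 0) :
    0 < (-1 : K) ^ negCount lam * ∏ a, lam a := by
  classical
  have hsplit : ∏ a, lam a = (∏ a ∈ Finset.univ.filter (fun a => lam a < 0), lam a) *
      ∏ a ∈ Finset.univ.filter (fun a => ¬ lam a < 0), lam a :=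
    (Finset.prod_filter_mul_prod_filter_not _ _ _).symm
  have hneg : ∏ a ∈ Finset.univ.filter (fun a => lam a < 0), lam a =
      (-1 : K) ^ negCount lam * ∏ a ∈ Finset.univ.filter (fun a => lam a < 0), (-lam a) := by
    rw [negCount, ← Finset.prod_const, ← Finset.prod_mul_distrib]
    exact Finset.prod_congr rfl fun a _ => by ring
  have hsq : (-1 : K) ^ negCount lam * (-1 : K) ^ negCount lam = 1 := by
    rw [← mul_pow, neg_one_mul, neg_neg, one_pow]
  rw [hsplit, hneg, ← mul_assoc, ← mul_assoc, hsq, one_mul]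
  refine mul_pos (Finset.prod_pos fun a ha => ?_) (Finset.prod_pos fun a ha => ?_)
  · exact neg_pos.mpr (Finset.mem_filter.mp ha).2
  · exact lt_of_le_of_ne (not_lt.mp (Finset.mem_filter.mp ha).2) (h a).symm

/-- SIGN LAW, scalar form: for non-degenerate `b` (all `λ_a ≠ 0`), `n!·∏λ_a > 0 ⟺ ind(b)` is EVEN. -/
theorem topCoeff_pos_iff_even_negCount {lam : Fin n → K} (h : ∀ a, lam a ≠ 0) :
    0 < topCoeff lam ↔ Even (negCount lam) := by
  have key := neg_one_pow_negCount_mul_prod_pos h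
  have hfac : (0 : K) < n.factorial := by positivity
  constructor
  · intro hpos
    rcases Nat.even_or_odd (negCount lam) with he | ho
    · exact he
    · rw [ho.neg_one_pow, neg_one_mul, neg_pos] at key
      exact absurd (mul_pos hfac (neg_pos.mpr key)) (by rw [mul_neg]; exact not_lt.mpr (le_of_lt (neg_neg_iff_pos.mpr hpos)))
  · intro he
    rw [he.neg_one_pow, one_mul] at key
    exact mul_pos hfac key

/-- … and `n!·∏λ_a < 0 ⟺ ind(b)` is ODD. -/
theorem topCoeff_neg_iff_odd_negCount {lam : Fin n → K} (h : ∀ a, lam a ≠ 0) :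
    topCoeff lam < 0 ↔ Odd (negCount lam) := by
  have hne : topCoeff lam ≠ 0 :=
    mul_ne_zero (by positivity) (Finset.prod_ne_zero_iff.mpr fun a _ => h a)
  rw [← Nat.not_even_iff_odd, ← topCoeff_pos_iff_even_negCount h, not_lt]
  exact ⟨le_of_lt, fun hle => lt_of_le_of_ne hle hne⟩

/-- negative definite `b` in EVEN dimension also has `n!·∏λ_a > 0` (sign-blindness of (H1) for `±Θ`). -/
theorem topCoeff_pos_of_neg_of_even {lam : Fin n → K} (hn : Even n) (h : ∀ a, lam a < 0) :
    0 < topCoeff lam := by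
  refine (topCoeff_pos_iff_even_negCount fun a => (h a).ne).mpr ?_
  have : negCount lam = n := by
    rw [negCount, Finset.filter_true_of_mem fun a _ => h a, Finset.card_univ, Fintype.card_fin]
  rwa [this]

/-- (H1) IN ITS EXACT SCOPE: for any functional `deg` with `deg(vol) > 0` («∫_X», complex orientation) and non-degenerate
`b(λ)`: `deg(b(λ)ⁿ) > 0 ⟺ ind(b)` is even. -/
theorem linearForm_pow_pos_iff_even_negCount {M : Type*} [AddCommGroup M] [Module K M]
    (deg : ExteriorAlgebra K M →ₗ[K] K) (e f : Fin n → M) {lam : Fin n → K} (h : ∀ a, lam a ≠ 0)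
    (hvol : 0 < deg (vol K e f)) : 0 < deg (diagForm K e f lam ^ n) ↔ Even (negCount lam) := by
  rw [linearForm_diagForm_pow_eq, ← topCoeff_pos_iff_even_negCount h]
  exact ⟨fun hp => (pos_iff_pos_of_mul_pos hp).mpr hvol, fun hp => mul_pos hp hvol⟩

/-- (H1) FOR A POLARISATION, LITERALLY (binder = positivity of the Hermitian form in the frame, conclusion = the degree
inequality): all `λ_a > 0` (an `H_b`-orthogonal frame of a POSITIVE DEFINITE `H_b`, i.e. `b` a Kähler/polarisation class) and
`deg(vol) > 0` (complex orientation) ⇒ `deg(b(λ)ⁿ) > 0`, every `n`. -/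
theorem linearForm_pow_pos_of_pos {M : Type*} [AddCommGroup M] [Module K M] (deg : ExteriorAlgebra K M →ₗ[K] K)
    (e f : Fin n → M) {lam : Fin n → K} (h : ∀ a, 0 < lam a) (hvol : 0 < deg (vol K e f)) :
    0 < deg (diagForm K e f lam ^ n) := by
  rw [linearForm_diagForm_pow_eq]
  exact mul_pos (topCoeff_pos_of_pos h) hvol

/-- … and for `-b` a polarisation (all `λ_a < 0`) at EVEN `n`: `deg(b(λ)ⁿ) > 0` as well. -/
theorem linearForm_pow_pos_of_neg_of_even {M : Type*} [AddCommGroup M] [Module K M]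
    (deg : ExteriorAlgebra K M →ₗ[K] K) (e f : Fin n → M) {lam : Fin n → K} (hn : Even n) (h : ∀ a, lam a < 0)
    (hvol : 0 < deg (vol K e f)) : 0 < deg (diagForm K e f lam ^ n) := by
  rw [linearForm_diagForm_pow_eq]
  exact mul_pos (topCoeff_pos_of_neg_of_even hn h) hvol

/-- COUNTER-MODEL to an UNCONDITIONAL (H1): `n = 4`, `λ = (1, 1, 1, -1)` (on paper: `X = E⁴`,
`b = e₁ + e₂ + e₃ - e₄`, non-degenerate of index 1): the top coefficient is `4!·(-1) = -24 < 0`. -/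
example : topCoeff ![(1 : ℚ), 1, 1, -1] = -24 := by
  simp [topCoeff, Fin.prod_univ_four, Nat.factorial]

/-- the `n = 2` sibling (on paper: `X = E²`, `b = e₁ - e₂`, `P = ⟨1 + pt, e₁ - e₂⟩`): top coefficient `2!·(1·(-1)) = -2 < 0`, so
there th-7's `(v,v)_χ = 2|xc|²(-4d)·∫b²/2! > 0` and the Lemma profile `(1,4,1)` (`χ = -2`) IS obstructed at `n = 2`. -/
example : topCoeff ![(1 : ℚ), -1] = -2 := by
  simp [topCoeff, Fin.prod_univ_two, Nat.factorial]

end Sign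

/-! ### §5 The SIGNED parity law (scalar chain of FORMULA-N-th7 §D with `sign ∫bⁿ` kept as a variable) -/

section ParityLaw

variable {K : Type*} [Field K] [LinearOrder K] [IsStrictOrderedRing K]

/-- th-7 §D's value of the Mukai self-pairing `(v,v)_χ` of a rational `K`-secant vector
`v = x·c·e^B + x̄·c̄·e^{B̄}` in EVEN dimension `n = 2m`: `2·w·(-4d)^m·I/(2m)!`, where `w = |x|²|c|² > 0`,
`d > 0` (the field is `ℚ(√-d)`) and `I = ∫_X bⁿ` (`B - B̄ = 2√-d·b`).  Pure arithmetic; the derivation of this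
value from HRR is th-7's (on paper). -/
def chiSelfEven (m : ℕ) (d w I : K) : K := 2 * w * (-4 * d) ^ m * I / ((2 * m).factorial : K)

/-- REPLAY of th-7's §D checker numbers «(κ,κ)_χ = -6, 48, -384 at n = 2, 4, 6 for κ = α + β′, d = 2» (formula_n_check.py
§(4)): there `e^{√-2·Θ} = α + √-2·β′`, so `κ = x·ℓ + x̄·ℓ̄` with `ℓ = e^{√-2 Θ}`, `c = 1`, `x = 1/2 - √-2/4`, `w = |x|² = 1/4 + 1/8 = 3/8`
(on paper, two lines), `b = Θ` principal so `I = ∫_X Θⁿ = n!`; the kernel value `chiSelfEven m 2 (3/8) ((2m)!) = (3/4)·(-8)^m`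
reproduces the three printed numbers exactly (a different route: closed form vs th-7's brute-force exterior-algebra code). -/
example : chiSelfEven 1 (2 : ℚ) (3 / 8) (Nat.factorial 2) = -6 := by norm_num [chiSelfEven, Nat.factorial]
/-- th-7's checker number at `n = 4`: `(κ,κ)_χ = 48`. -/
example : chiSelfEven 2 (2 : ℚ) (3 / 8) (Nat.factorial 4) = 48 := by norm_num [chiSelfEven, Nat.factorial]
/-- th-7's checker number at `n = 6`: `(κ,κ)_χ = -384`. -/
example : chiSelfEven 3 (2 : ℚ) (3 / 8) (Nat.factorial 6) = -384 := by norm_num [chiSelfEven, Nat.factorial]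

/-- sign separation: `(v,v)_χ = (-1)^m · (positive) · I`. -/
theorem chiSelfEven_eq (m : ℕ) (d w I : K) :
    chiSelfEven m d w I = (-1 : K) ^ m * I * (2 * w * (4 * d) ^ m / ((2 * m).factorial : K)) := by
  rw [chiSelfEven, show (-4 * d : K) = (-1) * (4 * d) by ring, mul_pow]
  ring

/-- the positive factor. -/
theorem chiSelfEven_factor_pos (m : ℕ) {d w : K} (hd : 0 < d) (hw : 0 < w) :
    0 < 2 * w * (4 * d) ^ m / ((2 * m).factorial : K) := by
  positivity

/-- `(v,v)_χ < 0 ⟺ (-1)^m · ∫bⁿ < 0`. -/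
theorem chiSelfEven_neg_iff (m : ℕ) {d w : K} (hd : 0 < d) (hw : 0 < w) (I : K) :
    chiSelfEven m d w I < 0 ↔ (-1 : K) ^ m * I < 0 := by
  rw [chiSelfEven_eq, mul_neg_iff]
  have hf := chiSelfEven_factor_pos m hd hw
  constructor
  · rintro (⟨_, hlt⟩ | ⟨hlt, _⟩)
    · exact absurd hlt (not_lt.mpr hf.le)
    · exact hlt
  · intro hlt
    exact Or.inr ⟨hlt, hf⟩

/-- THE SIGNED PARITY LAW (scalar form).  Hypotheses, all visible: `d > 0`, `w > 0`; (H2)+HRR in the form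
«`(v,v)_χ = g · χ^G` with `g = |G| > 0`»; the Lemma profile at even `n = 2m` gives `χ^G = P_n(-1) = -2`.
Conclusion: `(-1)^m · ∫bⁿ < 0`, i.e. `∫bⁿ > 0 ⇒ m` odd (`n ≡ 2 mod 4`, th-7's (S3) under (H1)) and
`∫bⁿ < 0 ⇒ m` even (`n ≡ 0 mod 4`: for `b` of ODD index the obstruction sits at `n ≡ 2 (mod 4)` instead). -/
theorem signed_parity_law (m : ℕ) {d w g I : K} (hd : 0 < d) (hw : 0 < w) (hg : 0 < g)
    (hHRR : chiSelfEven m d w I = g * (-2)) : (0 < I → Odd m) ∧ (I < 0 → Even m) := by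
  have hneg : (-1 : K) ^ m * I < 0 := by
    rw [← chiSelfEven_neg_iff m hd hw I, hHRR]
    linarith
  constructor
  · intro hI
    rcases Nat.even_or_odd m with he | ho
    · rw [he.neg_one_pow, one_mul] at hneg
      exact absurd hI (not_lt.mpr hneg.le)
    · exact ho
  · intro hI
    rcases Nat.even_or_odd m with he | ho
    · exact he
    · rw [ho.neg_one_pow, neg_one_mul, neg_neg_iff_pos] at hneg
      exact absurd hI (not_lt.mpr hneg.le)

/-- The same with `∫bⁿ = (n!·∏λ_a) · V`, `V = ∫_X vol > 0` (complex orientation) and `b` non-degenerate: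
Lemma-profile `G`-objects at `n = 2m` force `m + ind(b)` ODD.  For `ind(b) = 0` (every structure of record,
`b ∝ Θ`) this is th-7's «only for `n ≢ 0 (mod 4)`»; for `ind(b)` odd it is «only for `n ≡ 0 (mod 4)`». -/
theorem signed_parity_law_index (m : ℕ) {d w g V : K} (hd : 0 < d) (hw : 0 < w) (hg : 0 < g) (hV : 0 < V)
    (lam : Fin (2 * m) → K) (hlam : ∀ a, lam a ≠ 0)
    (hHRR : chiSelfEven m d w (topCoeff lam * V) = g * (-2)) : Odd (m + negCount lam) := by
  obtain ⟨h1, h2⟩ := signed_parity_law m hd hw hg hHRR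
  rcases Nat.even_or_odd (negCount lam) with he | ho
  · have hpos : 0 < topCoeff lam := (topCoeff_pos_iff_even_negCount hlam).mpr he
    exact (h1 (mul_pos hpos hV)).add_even he
  · have hneg : topCoeff lam < 0 := (topCoeff_neg_iff_odd_negCount hlam).mpr ho
    exact (h2 (mul_neg_of_neg_of_pos hneg hV)).add_odd ho

/-- NON-VACUITY WITNESS for the hypotheses of `signed_parity_law` / `signed_parity_law_index` (referee check A1–A6):
`m = 1` (`n = 2`), `d = 1`, `w = 1`, `λ = (1, 1)`, `V = 1` (so `I = 2!·1·1·1 = 2`), `g = |G| = 4`: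
`(v,v)_χ = 2·1·(-4)·2/2! = -8 = 4·(-2)`, and indeed `m + ind(b) = 1 + 0` is odd. -/
example : chiSelfEven 1 (1 : ℚ) 1 (topCoeff ![(1 : ℚ), 1] * 1) = 4 * (-2) := by
  norm_num [chiSelfEven, topCoeff, Nat.factorial]

/-- READING IN `n`: `m` odd ⟺ `n = 2m ≡ 2 (mod 4)`; `m` even ⟺ `4 ∣ n`. -/
theorem four_dvd_two_mul_iff (m : ℕ) : 4 ∣ 2 * m ↔ Even m := by
  constructor
  · rintro ⟨k, hk⟩; exact ⟨k, by omega⟩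
  · rintro ⟨k, hk⟩; exact ⟨k, by omega⟩

end ParityLaw

/-! ### §5c The `n = 4` clause with (H3) visible: the pinch `χ^G = 2e₀ - 2e₁ + 12 ≤ 0` against `(v,v)_χ > 0` -/

section PinchN4

variable {K : Type*} [Field K] [LinearOrder K] [IsStrictOrderedRing K]

/-- (H3) PINCH ARITHMETIC AT `n = 4` (FORMULA-N-th7 §C.2 / §D; SQUEEZE-n4 Cor P): with Serre symmetry `e₃ = e₁`, `e₄ = e₀` and the
pinch `e₂^G = r₂(4) = 12`, `χ^G = e₀ - e₁ + 12 - e₁ + e₀ ≤ 0` whenever `e₀^G ≤ 2` and `e₁^G ≥ 8` — the visible binder (H3). -/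
theorem pinch_n4_euler_nonpos {e₀ e₁ : ℤ} (h0 : e₀ ≤ 2) (h1 : 8 ≤ e₁) : e₀ - e₁ + 12 - e₁ + e₀ ≤ 0 := by
  omega

/-- THE `n = 4` CLAUSE OF (S3), scalar form with (H1), (H2), (H3) ALL VISIBLE: `d, w > 0`; (H1) `I = ∫b⁴ > 0`; (H2)+HRR
«`(v,v)_χ = g·χ^G`, `g = |G| > 0`» with `χ^G = e₀ - e₁ + e₂ - e₃ + e₄`, Serre `e₃ = e₁`, `e₄ = e₀`, pinch `e₂ = 12`; (H3) `e₀ ≤ 2`,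
`e₁ ≥ 8`.  Conclusion: contradiction — «at `n = 4` no secant-type object is `G`-semiregular at all» (for frames with (H1); for
`ind(b)` odd the sign of `(v,v)_χ` flips and this argument is void, cf. `signed_parity_law`). -/
theorem no_G_semiregular_secant_n4 {d w I g : K} (hd : 0 < d) (hw : 0 < w) (hg : 0 < g) (hI : 0 < I) {e₀ e₁ : ℤ}
    (h0 : e₀ ≤ 2) (h1 : 8 ≤ e₁) (hHRR : chiSelfEven 2 d w I = g * ((e₀ - e₁ + 12 - e₁ + e₀ : ℤ) : K)) : False := by
  have hpos : 0 < chiSelfEven 2 d w I := by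
    rw [chiSelfEven_eq]
    exact mul_pos (by rw [show ((-1 : K) ^ 2) = 1 by norm_num, one_mul]; exact hI) (chiSelfEven_factor_pos 2 hd hw)
  have hnonpos : g * ((e₀ - e₁ + 12 - e₁ + e₀ : ℤ) : K) ≤ 0 :=
    mul_nonpos_of_nonneg_of_nonpos hg.le (by exact_mod_cast pinch_n4_euler_nonpos h0 h1)
  exact absurd (hHRR ▸ hpos) (not_lt.mpr hnonpos)

end PinchN4


end Summit.Ventures.HSemireg.Mod4Sign
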